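import Summits.QuantumFields.BalabanUV.T4Continuum.Support.NE7LandauLinearSup
import HarnessLib

/-!
# NE7LandauExactSup — THE INTRINSIC SUP ∕ GRADIENT ∕ LAPLACIAN LETTERS OF A FIELD IN BAŁABAN'S EXACT CONSTRAINED LANDAU GAUGE `(1 − P)∂*z = 0`,
# WITH A NON-ZERO BLOCK AVERAGE `Q_k z`: `z = Δ_1⁻¹(½∂ᴴ∂z + Q*Qz)`, hence `|z| ≤ C·sup|F(z)| + C′·sup|Q*Qz|`, `|∇z|, |Δz| ≤ C·sup|½∂ᴴ∂z + Q*Qz|`,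
# k- AND N-UNIFORMLY (`NE7LandauExactSup`)

Cell `pub-balaban`, lineage `t4-ne7-p1` (CRUX PROVER NE7 #1 = OWNER of row NE7), gen 73; brick I-sup ∕ I-grad of ROAD v3 (`t4/b2b-balaban-t4-ne7-p1-g73/REP-FLAT-ROAD-v3.md`
§2 (I)): the letters that RESET the constants at every level of Bałaban's induction.  Gen 73's B1 `NE7LandauLinearSup` proved them for the linear Landau transform
`x₂ = x − ∂λ₀(∂*x)` of a field `x ∈ ker Q_k`; here they are stated INTRINSICALLY — for ANY field `z` on lit-balaban's torus `Tor (fine n M)` that satisfies the gauge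
condition `(1 − P)∂*z = 0` ([B8] (1.38) at `U₀ = 1`; `P = PcT`), WITHOUT assuming `Q_k z = 0`: by B5 (1.69) `Δ_1 = ½∂ᴴ∂ + ∂(1−P)∂* + Q*Q`, so `Δ_1 z = ½∂ᴴ∂z + Q*Qz`
and `z = Δ_1⁻¹(Σ_μ ∇_μ*Φ_μ(F(z))) + Δ_1⁻¹(Q*Qz)`; GAN24's entries give `|z| ≤ (d+1)C₃·sup|F(z)| + C₁·sup|Q*Qz|` (entries 3 and 1), `|∇_νz| ≤ C₂·sup|½∂ᴴ∂z + Q*Qz|`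
(entry 2), `|Δz| ≤ C₄·sup|…|` (entry 4) — EVERY `n = L^j`, EVERY period vector (k- and N-uniform: massive block propagator, exponentially decaying kernels).
USE (v3 §2 (I)): `z = log V^{G}` in the exact level-`j` gauge: `F(z)` = plaquettes `O(δ∕M²)` (+ BCH), `Q z` = the level datum `O(δ)`, `½∂ᴴ∂z = Σ∇*Φ(F)` = the current;
so `sup|z| = O(L^j·δ∕M² + δ∕L^j)` and, at the top with tangent-criticality, `|∇z| = O(δ∕M²)`.

CONTENT ([folklore]; 0 def, 0 sorry): §1 `DeltaA_of_gauge`, `eq_inv_of_gauge`; §2 **`exists_exact_sup_const`**; §3 **`exists_exact_grad_const`**, `exists_exact_lap_const`.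

HONEST FRAMING (page 1): [B8] Prop. 3's sup∕gradient∕Laplacian members at `U₀ = 1` in the LINEAR chart, stated for a field already in the gauge; nothing nonlinear,
nothing of Bałaban's curved statements; REP♭ NOT proved; (APE) NOT proved; NE7 NOT PRINTED ∕ NOT PROVED (0∕1); spine PROVED 0∕9; rung (B)+1 finite T⁴ — NOT
infinite volume, NOT mass gap, NOT BetaPertH, NOT Clay.  PLACEMENT: our lemma, under `Summits/QuantumFields/BalabanUV/`.
Continuum YM on T⁴ ⇐ BetaPertH ∧ nine spine estimates (0/9 proved); BetaPertH ⇐ (D1) ∧ (D4) ∧ CAP+tail; G-an2-4 gates asym, D1 and NE2/3/4.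
-/

set_option autoImplicit false

open scoped BigOperators Matrix ComplexConjugate
open Finset

namespace Summit.QuantumFields.BalabanUV.T4Continuum.NE7LandauExactSup

open Literature.MathematicalPhysics.QuantumFieldTheory.Balaban1983to89
open B5Prop11Plancherel (Tor fine fdiff)
open B5Action121 (Fs GradOp CurlOp)
open B5Block118 (QvOp)
open B5DeltaA169 (QvAdj)
open B5Prop11Lower (Lap)
open B5DeltaA169 (DeltaA DeltaA_eq_curl solution_eq calG_eq_DeltaA_inv)
open B5Value126 (PcT)
open B5G183Strip (kappa183 kappa183_pos)
open B5G183CovDecay (MD183 MD183_nonneg)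
open B4TorusKernel (periodConst)
open B4Sect5Proof (latticeConst latticeConst_nonneg)
open B5Kernel166Decay (periodConst_pos)
open B5G115SupBound (norm_DeltaA_one_inv_mulVec_le_global)
open Beta.GAN24.Entry110Rect (norm_fdiff_inv_mulVec_le norm_inv_fdiffH_mulVec_le norm_Lap_inv_mulVec_le)
open NE7LandauLinearSup (half_curlAdjCurl_eq_sum_fdiffH)

noncomputable section

variable {d : ℕ}

/-! ## §1 The representation `z = Δ_1⁻¹(½∂ᴴ∂z + Q*Qz)` in the exact gauge -/

section Gauge

variable (n : ℕ) [NeZero n] (M : Fin (d + 1) → ℕ) [∀ μ, NeZero (M μ)]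

/-- in the gauge `(1 − P)∂*z = 0`: `Δ_1 z = ½∂ᴴ∂z + Q*Qz` (B5 (1.69): `Δ_1 = ½∂ᴴ∂ + ∂(1−P)∂* + Q*Q`). [cite: Balaban1984PropagatorsI, (1.69) p.29 (text location; composition ours)] -/
theorem DeltaA_of_gauge (z : Tor (fine n M) × Fin (d + 1) → ℂ)
    (hz : (1 - PcT n M (n : ℂ)) *ᵥ ((GradOp (fine n M) (n : ℂ))ᴴ *ᵥ z) = 0) :
    DeltaA n M 1 *ᵥ z
      = (1 / 2 : ℂ) • (((CurlOp (fine n M) (n : ℂ))ᴴ * CurlOp (fine n M) (n : ℂ)) *ᵥ z) + (QvAdj n M * QvOp n M) *ᵥ z := by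
  rw [DeltaA_eq_curl n M (1 : ℝ)]
  simp only [Matrix.add_mulVec, Matrix.smul_mulVec, ← Matrix.mulVec_mulVec]
  rw [hz, Matrix.mulVec_zero, add_zero, Complex.ofReal_one, one_smul]

/-- **THE REPRESENTATION**: in the gauge `(1 − P)∂*z = 0`, `z = Δ_1⁻¹(½∂ᴴ∂z + Q*Qz)`. [folklore] -/
theorem eq_inv_of_gauge (z : Tor (fine n M) × Fin (d + 1) → ℂ)
    (hz : (1 - PcT n M (n : ℂ)) *ᵥ ((GradOp (fine n M) (n : ℂ))ᴴ *ᵥ z) = 0) :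
    z = (DeltaA n M 1)⁻¹ *ᵥ ((1 / 2 : ℂ) • (((CurlOp (fine n M) (n : ℂ))ᴴ * CurlOp (fine n M) (n : ℂ)) *ᵥ z) + (QvAdj n M * QvOp n M) *ᵥ z) := by
  have hn1 : 1 ≤ n := Nat.one_le_iff_ne_zero.mpr (NeZero.ne n)
  rw [← calG_eq_DeltaA_inv n hn1 M 1 one_pos]
  exact solution_eq n hn1 M 1 one_pos (DeltaA_of_gauge n M z hz)

end Gauge

/-! ## §2 THE SUP LETTER -/

/-- **SUP LETTER IN THE EXACT GAUGE** ([B8] Prop. 3's sup member at `U₀ = 1`, linear chart, non-zero block average): `∃ C, C′ > 0` (functions of `d`) such that for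
every `n, M`, every `z` with `(1 − P)∂*z = 0` and bounds `|F(z)| ≤ B`, `|(Q*Qz)(i)| ≤ B′`: **`|z(i)| ≤ C·B + C′·B′`** at every bond. [folklore] -/
theorem exists_exact_sup_const :
    ∃ C C' : ℝ, 0 < C ∧ 0 < C' ∧ ∀ (n : ℕ) [NeZero n] (M : Fin (d + 1) → ℕ) [∀ μ, NeZero (M μ)]
      (z : Tor (fine n M) × Fin (d + 1) → ℂ), (1 - PcT n M (n : ℂ)) *ᵥ ((GradOp (fine n M) (n : ℂ))ᴴ *ᵥ z) = 0 →
      ∀ B : ℝ, (∀ (μ ν : Fin (d + 1)) (t : Tor (fine n M)), ‖Fs (fine n M) (n : ℂ) z μ ν t‖ ≤ B) →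
      ∀ B' : ℝ, (∀ j, ‖((QvAdj n M * QvOp n M) *ᵥ z) j‖ ≤ B') →
      ∀ i : Tor (fine n M) × Fin (d + 1), ‖z i‖ ≤ C * B + C' * B' := by
  obtain ⟨C₃, hC₃, h3⟩ := norm_inv_fdiffH_mulVec_le (d := d)
  have hκ : 0 < kappa183 (d + 1) / (d + 1) := div_pos (kappa183_pos (d + 1)) (by positivity)
  set K : ℝ := 2 * d * 2 ^ d * Real.exp (1 / (2 * (d + 1))) * latticeConst (d + 1) (1 / (2 * (d + 1)))
      + (d + 1) * (MD183 (d + 1) d * periodConst (kappa183 (d + 1)) d * latticeConst (d + 1) (kappa183 (d + 1) / (d + 1))) with hK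
  have hK0 : 0 ≤ K := by
    have h1 : 0 ≤ latticeConst (d + 1) (1 / (2 * ((d : ℝ) + 1))) := latticeConst_nonneg _ (by positivity)
    have h2 : 0 ≤ latticeConst (d + 1) (kappa183 (d + 1) / (d + 1)) := latticeConst_nonneg _ hκ.le
    have h3' : 0 ≤ MD183 (d + 1) d := MD183_nonneg _ _
    have h4 : 0 ≤ periodConst (kappa183 (d + 1)) d := (periodConst_pos (kappa183_pos (d + 1)) d).le
    positivity
  refine ⟨((d + 1 : ℕ) : ℝ) * C₃, K + 1, by positivity, by positivity, fun n _ M _ z hz B hB B' hB' i => ?_⟩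
  have hn1 : 1 ≤ n := Nat.one_le_iff_ne_zero.mpr (NeZero.ne n)
  have hB'0 : 0 ≤ B' := (norm_nonneg _).trans (hB' i)
  rw [eq_inv_of_gauge n M z hz, Matrix.mulVec_add, half_curlAdjCurl_eq_sum_fdiffH, Matrix.mulVec_sum]
  refine (norm_add_le _ _).trans (add_le_add ?_ ?_)
  · rw [Finset.sum_apply]
    calc ‖∑ μ, ((DeltaA n M 1)⁻¹ *ᵥ ((fdiff (fine n M) (n : ℂ) μ)ᴴ *ᵥ
              (fun j : Tor (fine n M) × Fin (d + 1) => Fs (fine n M) (n : ℂ) z μ j.2 j.1))) i‖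
        ≤ ∑ μ : Fin (d + 1), ‖((DeltaA n M 1)⁻¹ *ᵥ ((fdiff (fine n M) (n : ℂ) μ)ᴴ *ᵥ
              (fun j : Tor (fine n M) × Fin (d + 1) => Fs (fine n M) (n : ℂ) z μ j.2 j.1))) i‖ := norm_sum_le _ _
      _ ≤ ∑ _μ : Fin (d + 1), C₃ * B := Finset.sum_le_sum fun μ _ => h3 n M μ _ B (fun j => hB μ j.2 j.1) i
      _ = ((d + 1 : ℕ) : ℝ) * C₃ * B := by rw [Finset.sum_const, Finset.card_univ, Fintype.card_fin, nsmul_eq_mul]; ring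
  · calc _ ≤ B' * K := norm_DeltaA_one_inv_mulVec_le_global n hn1 M (Nn := d) le_rfl _ hB' i
      _ ≤ (K + 1) * B' := by nlinarith

/-! ## §3 THE GRADIENT AND LAPLACIAN LETTERS from the sup of the source `½∂ᴴ∂z + Q*Qz` -/

/-- **GRADIENT LETTER IN THE EXACT GAUGE**: `|(∇_ν z)(i)| ≤ C·B″` under `|½∂ᴴ∂z + Q*Qz| ≤ B″` (GAN24's second entry) — at the top of the road the source is the CURRENT
plus the lifted datum, both `O(δ∕M³)` in lattice units for a tangent-critical field, whence the gradient member `O(δ∕M²)`. [folklore] -/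
theorem exists_exact_grad_const :
    ∃ C : ℝ, 0 < C ∧ ∀ (n : ℕ) [NeZero n] (M : Fin (d + 1) → ℕ) [∀ μ, NeZero (M μ)]
      (z : Tor (fine n M) × Fin (d + 1) → ℂ), (1 - PcT n M (n : ℂ)) *ᵥ ((GradOp (fine n M) (n : ℂ))ᴴ *ᵥ z) = 0 →
      ∀ B'' : ℝ, (∀ j, ‖((1 / 2 : ℂ) • (((CurlOp (fine n M) (n : ℂ))ᴴ * CurlOp (fine n M) (n : ℂ)) *ᵥ z) + (QvAdj n M * QvOp n M) *ᵥ z) j‖ ≤ B'') →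
      ∀ (ν : Fin (d + 1)) (i : Tor (fine n M) × Fin (d + 1)), ‖(fdiff (fine n M) (n : ℂ) ν *ᵥ z) i‖ ≤ C * B'' := by
  obtain ⟨C₂, hC₂, h2⟩ := norm_fdiff_inv_mulVec_le (d := d)
  refine ⟨C₂, hC₂, fun n _ M _ z hz B'' hB ν i => ?_⟩
  have h := h2 n M ν _ B'' hB i
  rwa [← eq_inv_of_gauge n M z hz] at h

/-- **LAPLACIAN LETTER IN THE EXACT GAUGE**: `|(Δz)(i)| ≤ C·B″` under `|½∂ᴴ∂z + Q*Qz| ≤ B″` (GAN24's fourth entry). [folklore] -/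
theorem exists_exact_lap_const :
    ∃ C : ℝ, 0 < C ∧ ∀ (n : ℕ) [NeZero n] (M : Fin (d + 1) → ℕ) [∀ μ, NeZero (M μ)]
      (z : Tor (fine n M) × Fin (d + 1) → ℂ), (1 - PcT n M (n : ℂ)) *ᵥ ((GradOp (fine n M) (n : ℂ))ᴴ *ᵥ z) = 0 →
      ∀ B'' : ℝ, (∀ j, ‖((1 / 2 : ℂ) • (((CurlOp (fine n M) (n : ℂ))ᴴ * CurlOp (fine n M) (n : ℂ)) *ᵥ z) + (QvAdj n M * QvOp n M) *ᵥ z) j‖ ≤ B'') →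
      ∀ i : Tor (fine n M) × Fin (d + 1), ‖(Lap n M *ᵥ z) i‖ ≤ C * B'' := by
  obtain ⟨C₄, hC₄, h4⟩ := norm_Lap_inv_mulVec_le (d := d)
  refine ⟨C₄, hC₄, fun n _ M _ z hz B'' hB i => ?_⟩
  have h := h4 n M _ B'' hB i
  rwa [← eq_inv_of_gauge n M z hz] at h

end

end Summit.QuantumFields.BalabanUV.T4Continuum.NE7LandauExactSup
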